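/-
Copyright (c) 2026 the pub-hodgecm-mathlib formalisation cell (harness21).  R90-TF SLAB, section S10 (Rogawski 1990, Ch. 13.5–13.8 comparison engine read at `v`),
typist R90-C138-typ4 (g0) — FILE C2 (DEFS, 0 sorry; DEAL #3 15:46:21Z, J-A∕C2-1 NESTING, (β) 15:50:48Z, J-A∕HC-1 (a)); h413 = `stmt-HodgeConjecture-24833`, route `HCCMUnconditional`.
-/
import Summits.HodgeConjecture.HodgeConjecture.Theorems.K2E1SpectralTermsDiscreteHalf              -- ★ `DiscreteClass`, `DiscreteClass.mult`, `DiscreteClass.classTrace` (GLOBAL class traces)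
import Summits.HodgeConjecture.HodgeConjecture.Theorems.F0P3GlobalPacketDiscrete                   -- ★ `cmOccursInDiscreteSpectrum(_iff)`
import Summits.HodgeConjecture.HodgeConjecture.Theorems.R90S10ArchSignKitDefs                      -- ★ p861993 (S10 FILE E's DEFINITIONS): `phi3`, `GInf`, `HInf`, `IsArchStablyNull`, `IsArchSignTest`, `archDeltaPP`, `ArchSignKit`
import Summits.HodgeConjecture.HodgeConjecture.Theorems.K2E1Pinned1383InputsOfLocSmooth           -- ★ `flath_conjuncts_of_inputs_of_locSmooth` (its (B1)–(B3)∕(B1_H)–(B3_H) binders ARE fields below)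
import Literature.NumberTheory.Rogawski1990.AdelicDeltaTransfer                                    -- ★ `IsArchDeltaTransfer`, `ArchTransferFactor`, `archStableOrbitalIntegral`, local sides
import Literature.NumberTheory.Rogawski1990.ArchExplicitTransferFactor                            -- ★ `archExplicitDelta` (the explicit `Δ″_∞`)
import Literature.NumberTheory.Rogawski1990.ArchCompatibleFamilies                                -- ★ `ArchCompatibleFamiliesH`, ★ `OrbitalMeasureFamily.IsQuotientOf` (print's measure convention at ∞)
import Summits.HodgeConjecture.HodgeConjecture.Theorems.K2E1bArchPacketSignsDefs                   -- ★ `HasArchOpTrace` (E1b's junk-free archimedean operator trace; FILE E's currency)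
import HarnessLib

/-!
# R90-TF ∕ S10 — FILE C2: the FROZEN DATUM of (13.8.3) as NESTED STRUCTURES (defs only, 0 sorry)
# (`Theorems/R90S10FrozenDatumDefs.lean`; ns `Summit.HodgeConjecture.HodgeConjecture.R90.S10`; L9 order of record ★ → C → (E) → C2 → B → A, D → C2)

PLAN OF RECORD: SOCKET-PLAN-S10 v1.2 (cbd25c9174d63f92) + HEADS-C∕B.v2 (e238463ed36e4f8c) + DEAL #3 (R90 bus 15:46:21Z (1)–(6)) + audits S10#0–#4, (β-1)…(β-5),
R1–R3 (15:53:29Z), S10#E (E-F2∕E-F3) ADOPTED; typ3 J-A∕C2-1 (nesting) + J-A∕HC-1 (a) (core ⊂ cut) + J-A∕HC-2 (honesty of the finiteness clauses).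
Print: [Rogawski1990] = J. Rogawski, *Automorphic Representations of Unitary Groups in Three Variables*, Ann. of Math. Stud. 123 (1990), §13.8 Prop. 13.8.3 (proof)
pp. 218–219 (lit key `book:rogawski1990-automorphic-representations-unitary-groups-three-variables`, p0211.txt:L3–L28, p0212.txt:L1–L7).

## WHAT THIS FILE TYPES (every datum entering one side of (13.8.3) is a FIELD or a pinning PROOF FIELD — audit F1: no free functional, no free freezing map, no posited
## packet type; a structure-update `{𝔤 with νG := 2 • νG}` ∕ `{𝔳 with ΦG := 0}` breaks a named field), in print's dependency order p. 218 L9 → L11–28 → (13.8.3) → p. 219 L1–7: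
* §0  reducible carriers `G3`∕`H2`∕`H1` (SPELLED through ★ `adelicGroupData`, the spelling ★ `DiscreteAutomorphicRep`'s instances key on), `H2Loc`∕`H1Loc` (★ `cmDatum` locals =
      the factors of ★ `HLoc`), `GArch`∕`HArch`∕`H2Arch`, and the archimedean orbital-family types `ArchOrbFamG`∕`ArchOrbFamH` at the BOREL quotient structures (★
      `ArchCompatibleFamiliesH`'s own convention);
* §0b `MatchE1` (★ `Pinned1383Letter` :121–122 TOKENS, reducible), `HasLocalClasses` + `IsLinked` (★ `cmOccursInDiscreteSpectrum_iff`'s body, with ∕ without the witness as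
      data), the `b`-FREE fibre condition `LiesOver` [p. 219 L3], the `θ_v`-reduction `xiReduce` [E2-a, now typed];
* §1  `structure S10HDatum` — the global `H`-datum `ρ = ρ₂ ⊠ θ` [p. 218 L9 (i)–(iii)]: ONE primitive occurrence witness `PH : DiscreteAutomorphicRep` on ★ `cmDatum L 2 Φ₂`
      (ruling (f)) with `mult [PH] = 1` [Thm. 11.5.1 (c) p. 165], its finite component and local classes `ρ₂`, the automorphic `U(Φ₁)`-line `θ` with its character
      `χv` at `v` PINNED by the trace [E2-a], the (B·_H) restricted-tensor data of ★ `flath_conjuncts_of_inputs_of_locSmooth` :95–:107 VERBATIM, the factor links,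
      `hpin` (★ :107), and PRINT'S ARCHIMEDEAN MEASURE CONVENTION: Haar `ν_∞`, `ν_{H,∞}`, torus measures `t`, `t_H`, orbital families `m_∞ = dν_∞∕dt` (★ `IsQuotientOf`, Weil
      form) and `(W_H)+(C_H)` (★ `ArchCompatibleFamiliesH`) [§1.7 p. 6; §4.3 p. 43] — NOT ★ `IsCanonical` at ∞ (S10#E E-F2: unsatisfiable for non-compact real tori); THE
      `H`-SIDE CUT = the FULL `t(ρ)`-fibre `dρ : J → DiscreteClass` (finite, injective, each `m = 1`, frozen-vector-FREE exhaustiveness; AUDIT S10#5 F6) [Prop. 11.2.1 (a) p. 161;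
      Thm. 11.5.1 (c) p. 165]; the archimedean PACKET representation `ρi` (FILE E's Hilbert-space currency), ONE ∃-closed archimedean clause `harch` (E-D1∕E-D2 bodies VERBATIM,
      `Θ_{ρ_∞}(f^H_∞) = 2` in ★ `HasArchOpTrace`, transfer at the factor of record `archDeltaPP` = E's `archDeltaPP` body; plan RECONCILED RULING (i)) and the LINK LAW
      `hpacki` «global–archimedean Flath split over the packet cut» [p. 218 L22–L26; FlathCorvallis1979 Thm. 3];
* §2  `structure S10Frozen 𝔥` — the frozen vectors [p. 218 L20–28, p. 219 L2]: levels `K`∕(`KH` in 𝔥), the finite-adelic Haar data (B4)∕Tate, `f_∞`, `f^H_∞`, N1 «`f_∞` STABLY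
      NULL» (E-D1 body), `Θ_ϖ(f_∞) ∈ {0, ±1}` (E-D2 body), `Θ_{ρ_∞}(f^H_∞) = 2`, `f_∞ → f^H_∞` (★ `IsArchDeltaTransfer` at `archDeltaPP`), the `θ_∞`-reduction pin of
      `fHi₂`, the freezing maps `ΦG`, `ΦH` PINNED
      POINTWISE (★ `archPart`, ★ `toLocal`, `∏ᶠ` over `{w ∕∕ w ≠ v}`), the OFF-`v` per-place Haar measures ∕ CANONICAL orbital families ∕ `vol(K_w) = 1` ∕ unit ↔ unit `Δ_w`-transfers
      (★ `IsLocalDeltaTransfer` at ★ `finExplicitCollection … w`) [§4.9 Prop. 4.9.1 p. 55];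
* §3  (dissolved by AUDIT S10#5 F6: the `H`-side cut lives in `S10HDatum`; (B1_H)+«`aH = 2`» is the READ-OFF `S10Frozen.hsplitH_two` of §5);
* §4  `structure S10GCutCore 𝔥 𝔳` ⊂ `structure S10GCut 𝔥 𝔳` (J-A∕HC-1 (a)) — the `G`-side cut [(13.8.3) p. 218 L5–7 «the sum is over cuspidal π on G such that
      ψ_G(t(π)) = t»]: a COUNTABLE ((β): `hcount`, payer ★ `OccursCountable`) injective family of ONE primitive witness `P i : DiscreteAutomorphicRep` each (audit (B-d)), the
      (B1)–(B3) restricted-tensor data :80–:93 VERBATIM with `loc i w := [ρc i w]` DEFINED, `0 < mult < ⊤`, signs `ε = ±1` = the Flath scalars (`hsign`; the TRACE-BASED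
      archimedean membership clause, S10#E E-F3), THE FIBRE: members LIE OVER `ρ_w` at every `w ≠ v` (`hfib`) and EVERY discrete class satisfying the ONE membership predicate
      `S10MemG` that CONTRIBUTES for some matched pair is a member (`hexh`, `φ`-UNIFORM, N2; audit R1); the extension adds the two HONEST finiteness clauses `hsuppG` (finite
      support of the weighted trace vector for each matched pair) and `hfibre` (finite fibres over each `π_v`) [Harish-Chandra; BorelJacquet1979 §4.3] (J-A∕HC-2: true because
      members are `K^v`-spherical (`LiesOver`) with archimedean trace `±1` against the `K_∞`-finite `f_∞`);
* §5  `structure S10FrozenDatum := ⟨𝔥, 𝔳, 𝔤⟩` + the read-offs `S10Frozen.hsplitH_two` ((B1_H) with `aH = 2`), `S10GCutCore.cl∕loc∕hocc∕hloc∕memG` FILE A feeds to ★ `Pinned1383Letter`'s body;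
      the read-offs (`section Pinned`) live in the COMPANION module `Theorems/R90S10FrozenDatumPinned.lean` (gate lint `lint.statement-form`: a Theorems file with proofs is ≤ 400 l.);
      the PINNED FUNCTIONALS `mOf`, `trGPinned i φ := Tr [P i](ΦG φ)`, `trHPinned f^H := Σ_j m_j Tr ρ_j(ΦH f^H)` over FILE C's `classTraceAt`∕`weightedCutSum` live in LINES B (plan R-L9-2)
CONSUMERS: FILE B (`sock_S10_stabilisedAtEvp : ∀ 𝔣, StabilisedAtEvpHyp L v (mOf 𝔣) (MatchE1 …) (trGPinned 𝔣) (trHPinned 𝔣)` + PROVED head), FILE A (`Nonempty (S10HDatum …)` ∕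
`∀ 𝔥, Nonempty (S10Frozen 𝔥)` ∕ `∀ 𝔥 𝔳, Nonempty (S10GCutCore 𝔥 𝔳)` + A2e `∀ 𝔤₀ : S10GCutCore …, ‹hsuppG› ∧ ‹hfibre›`), FILE D ED. 2 (corollary onto B1).
ED. 2 SLOTS (named, not typed here): (E2-c) the GLOBAL «`ρ` not of the form `ρ(θ)`» feeding L. 13.6.3's separation (today inside B1's payment); (E2-e) `K_∞`-finiteness of `f_∞`
(J-A∕HC-2's archimedean clause for A2e's Harish-Chandra payer); (E2-E) after FILE E (typ1 g2) is in the tree: `𝔞 : R90.S10.ArchSignKit …` in `S10HDatum` + `hfrozen : fG∞ = ⇑𝔞.frozenG`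
(additive; J-E∕C2-1), so that `haH`∕`hsign` are DERIVED from E-R1∕E-R2 + Flath in A's payers.
HONEST LABEL: definitions only; 0 `sorry`; closes nothing; HC_CM is proved only modulo the 7 printed citations (2 remaining named inputs: hLiu418 = `stmt-HodgeConjecture-24832`,
h413 = `stmt-HodgeConjecture-24833`) until rung 0 closes; REL ≠ ★ ≠ BUILT.
-/

set_option autoImplicit false
set_option linter.dupNamespace false

noncomputable section

open scoped RestrictedProduct Matrix MatrixGroups
open Filter MeasureTheory NumberField IsDedekindDomain CompactlySupported
open Literature.NumberTheory.Rogawski1990 Literature.NumberTheory.Automorphic Literature.NumberTheory.Automorphic.UnitaryGroup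
open Literature.NumberTheory.Automorphic.UnitaryGroup.CotangentForms Literature.NumberTheory.GaloisRepresentations
open Literature.NumberTheory.Automorphic.Arthur2013.Leaves.TECR
open Summit.HodgeConjecture.HodgeConjecture.Cruxes.H413.F0P3GlobalPacketDiscrete (cmOccursInDiscreteSpectrum cmOccursInDiscreteSpectrum_iff)
open Summit.HodgeConjecture.HodgeConjecture.Cruxes.H413.K2E1TraceFormulaBeta
open Summit.HodgeConjecture.HodgeConjecture.Cruxes.H413.K2E1SpectralTermsDiscreteHalf
open Summit.HodgeConjecture.HodgeConjecture.Cruxes.H413.K2E1bGKCohomologyU21.U8 (HasArchOpTrace)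

namespace Summit.HodgeConjecture.HodgeConjecture.R90.S10

/-! ## §0 Carriers (reducible abbreviations; the `Φ₂`, `Φ₁` literals are those of ★ `HLoc`) -/

/-- `G = U(Φ₃)` over `L⁺` as an adelic group datum, SPELLED through ★ `adelicGroupData` (`Φ₃ = qsForm L`). [cite: Rogawski1990, §13.6 p. 208] -/
abbrev G3 (L : Type) [Field L] [NumberField L] [IsCMField L] : AdelicGroupData ↥(maximalRealSubfield L) :=
  adelicGroupData (↥(maximalRealSubfield L)) L (IsCMField.complexConj L) 3 (qsForm L)

/-- The `U(Φ₂)`-factor of `H = U(Φ₂) × U(Φ₁)` as an adelic group datum (★ `adelicGroupData`, the `Φ₂` literal of ★ `HLoc`). [cite: Rogawski1990, §4.9 p. 54] -/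
abbrev H2 (L : Type) [Field L] [NumberField L] [IsCMField L] : AdelicGroupData ↥(maximalRealSubfield L) :=
  adelicGroupData (↥(maximalRealSubfield L)) L (IsCMField.complexConj L) 2 (Matrix.of fun i j : Fin 2 => if i.val + j.val + 1 = 2 then (1 : L) else 0)

/-- The `U(Φ₁)`-factor of `H` as an adelic group datum (★ `adelicGroupData`, the `Φ₁` literal of ★ `HLoc`). [cite: Rogawski1990, §4.9 p. 54] -/
abbrev H1 (L : Type) [Field L] [NumberField L] [IsCMField L] : AdelicGroupData ↥(maximalRealSubfield L) :=
  adelicGroupData (↥(maximalRealSubfield L)) L (IsCMField.complexConj L) 1 (Matrix.of fun i j : Fin 1 => if i.val + j.val + 1 = 1 then (1 : L) else 0)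

/-- `U(Φ₂)(L⁺_w)`, the first factor of ★ `HLoc L w` (★ `cmDatum` spelling, reducible). [cite: Rogawski1990, §4.9 p. 54] -/
abbrev H2Loc (L : Type) [Field L] [NumberField L] [IsCMField L] (w : Pl L) : Type :=
  (UnitaryGroup.cmDatum L 2 (Matrix.of fun i j : Fin 2 => if i.val + j.val + 1 = 2 then (1 : L) else 0)).Local w

/-- `U(Φ₁)(L⁺_w)`, the second factor of ★ `HLoc L w` (★ `cmDatum` spelling, reducible). [cite: Rogawski1990, §4.9 p. 54] -/
abbrev H1Loc (L : Type) [Field L] [NumberField L] [IsCMField L] (w : Pl L) : Type :=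
  (UnitaryGroup.cmDatum L 1 (Matrix.of fun i j : Fin 1 => if i.val + j.val + 1 = 1 then (1 : L) else 0)).Local w

/-- The archimedean group `G_∞ = U(Φ₃)(L⁺ ⊗ ℝ)` as a type (★ `UnitaryGroup.arch`). [cite: Rogawski1990, §14.2 p. 232] -/
abbrev GArch (L : Type) [Field L] [NumberField L] [IsCMField L] : Type :=
  GInf L

/-- The archimedean group `H_∞ = (U(Φ₂) × U(Φ₁))(L⁺ ⊗ ℝ)` as a type (the carrier of ★ `ArchTransferFactor`). [cite: Rogawski1990, §14.3 pp. 233–234] -/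
abbrev HArch (L : Type) [Field L] [NumberField L] [IsCMField L] : Type :=
  HInf L

/-- The archimedean `U(Φ₂)`-factor `U(Φ₂)(L⁺ ⊗ ℝ)` as a type. [cite: Rogawski1990, §14.2 p. 232] -/
abbrev H2Arch (L : Type) [Field L] [NumberField L] [IsCMField L] : Type :=
  ↥(UnitaryGroup.arch (↥(maximalRealSubfield L)) L (IsCMField.complexConj L) 2 (Matrix.of fun i j : Fin 2 => if i.val + j.val + 1 = 2 then (1 : L) else 0))

/-- Orbital measure families on `G_∞` AT THE BOREL STRUCTURES of the centraliser quotients (★ `ArchCompatibleFamiliesG`'s own `letI … := borel _` convention, so that ★'s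
archimedean predicates apply with their implicit quotient structures filled by `fun _ => borel _`). [cite: Rogawski1990, §4.3 (4.3.1) p. 43] -/
abbrev ArchOrbFamG (L : Type) [Field L] [NumberField L] [IsCMField L] : Type :=
  @OrbitalMeasureFamily (GArch L) _ (fun _ => borel _)

/-- Orbital measure families on `H_∞` at the Borel quotient structures (the `mH` parameter type of ★ `ArchCompatibleFamiliesH`, verbatim). [cite: Rogawski1990, §4.3 (4.3.1) p. 43] -/
abbrev ArchOrbFamH (L : Type) [Field L] [NumberField L] [IsCMField L] : Type :=
  @OrbitalMeasureFamily (HArch L) _ (fun _ => borel _)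

/-- The archimedean `U(Φ₁)`-factor `U(Φ₁)(L⁺ ⊗ ℝ)` as a type (the second factor of `HArch`). [cite: Rogawski1990, §14.2 p. 232] -/
abbrev H1Arch (L : Type) [Field L] [NumberField L] [IsCMField L] : Type :=
  ↥(UnitaryGroup.arch (↥(maximalRealSubfield L)) L (IsCMField.complexConj L) 1 (Matrix.of fun i j : Fin 1 => if i.val + j.val + 1 = 1 then (1 : L) else 0))

/-- ★ `HasArchOpTrace` with the Hilbert-space structures as IMPLICIT binders (read off `ϖ` by unification, so that a sub-structure can state it about another structure's
representation field without instances in scope); `HasArchOpTraceI ν ϖ hu hsc f c ↔ HasArchOpTrace ν ϖ hu hsc f c` is `Iff.rfl`. [cite: Knapp1986, Thm. 10.2] -/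
def HasArchOpTraceI {G : Type*} [Group G] [TopologicalSpace G] [MeasurableSpace G] [BorelSpace G] (ν : Measure G) [IsFiniteMeasureOnCompacts ν]
    {E : Type} {_i₁ : NormedAddCommGroup E} {_i₂ : InnerProductSpace ℂ E} {_i₃ : CompleteSpace E}
    (ϖ : ContRepresentation ℂ G E) (hu : ϖ.IsUnitary) (hsc : ϖ.IsStronglyContinuous) (f : C_c(G, ℂ)) (c : ℂ) : Prop :=
  HasArchOpTrace ν ϖ hu hsc f c

/-! ## §0b The matching relation of the letter, the class ↔ local-classes links, the `b`-free fibre condition, the `θ_v`-reduction -/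

/-- **`MatchE1`** — the tier-0 matching relation of ★ `Pinned1383Letter` :121–122, TOKEN FOR TOKEN (reducible, so that FILE A's `exact` meets the letter's literal lambda):
`f^H`, `φ` locally smooth and `φ → f^H` a `Δ`-transfer at the place `w` for the EXPLICIT factor ★ `finExplicitCollection … w` and the orbital measure families `mHw`, `mQw`.
[cite: Rogawski1990, §4.9 Prop. 4.9.1 p. 55; §13.8 p. 218] -/
abbrev MatchE1 (L : Type) [Field L] [NumberField L] [IsCMField L] (μ : HeckeCharacter L) (w : Pl L)
    [∀ a : HLoc L w, MeasurableSpace (HLoc L w ⧸ Subgroup.centralizer ({a} : Set (HLoc L w)))]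
    [∀ γ : Gqs L w, MeasurableSpace (Gqs L w ⧸ Subgroup.centralizer ({γ} : Set (Gqs L w)))]
    (mHw : OrbitalMeasureFamily (HLoc L w)) (mQw : OrbitalMeasureFamily (Gqs L w)) (fH : HLoc L w → ℂ) (φ : Gqs L w → ℂ) : Prop :=
  IsLocSmooth fH ∧ IsLocSmooth φ ∧
    IsLocalDeltaTransfer L (qsForm L) w ((finExplicitCollection L (qsForm L) μ (finExplicitDelta_conj_left_all L (qsForm L) μ)
      (finExplicitDelta_conj_right_all L (qsForm L) μ)) w) mHw mQw fH φ

/-- **`HasLocalClasses N H σf π`** — the finite-adelic representation `σf` of `U(H)(𝔸_f)` is irreducible, smooth, admissible, and its local constituents at every finite `w` are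
EXACTLY the class `π w` (the four witness-free conjuncts of ★ `cmOccursInDiscreteSpectrum_iff`'s body). [cite: Rogawski1990, §13.3 p. 199 ¶2] [cite: FlathCorvallis1979, Thm. 3] -/
def HasLocalClasses (L : Type) [Field L] [NumberField L] [IsCMField L] (N : ℕ) (H : Matrix (Fin N) (Fin N) L) {W : Type} {_acW : AddCommGroup W} {_mdW : Module ℂ W}
    (σf : Representation ℂ (finAdelic (↥(maximalRealSubfield L)) L (IsCMField.complexConj L) N H) W)
    (π : ∀ w : Pl L, IrrClass ((UnitaryGroup.cmDatum L N H).Local w)) : Prop :=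
  σf.IsIrreducible ∧ σf.IsSmooth ∧ σf.IsAdmissible ∧
    ∀ (w : Pl L) (c₀ : IrrClass (localPi L (IsCMField.complexConj L) N H w)),
      c₀.IsConstituentOf (σf.comp (inclPlace (↥(maximalRealSubfield L)) L (IsCMField.complexConj L) N H w)) ↔
        c₀ = IrrClass.comap (localPiEquiv L (IsCMField.complexConj L) N H w) (π w)

/-- **`IsLinked N H μA c π`** — the discrete class `c` of `U(H)` IS the class of SOME occurrence witness `P` whose finite component has the local classes `π w`: the body of ★
`cmOccursInDiscreteSpectrum_iff` with the extra conjunct `DiscreteClass.mk P = c` (class and «its» local components cannot drift apart — audit F1 (iv)).  Used on the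
HYPOTHESIS side of the exhaustiveness fields (any witness); members carry their witness as DATA (audit (B-d)). [cite: Rogawski1990, §13.3 p. 199 ¶2] [cite: FlathCorvallis1979, Thm. 3] -/
def IsLinked (L : Type) [Field L] [NumberField L] [IsCMField L] (N : ℕ) (H : Matrix (Fin N) (Fin N) L)
    (μA : Measure (adelicGroupData (↥(maximalRealSubfield L)) L (IsCMField.complexConj L) N H).automorphicQuotient)
    [(adelicGroupData (↥(maximalRealSubfield L)) L (IsCMField.complexConj L) N H).IsAutomorphicMeasure μA]
    (c : DiscreteClass (adelicGroupData (↥(maximalRealSubfield L)) L (IsCMField.complexConj L) N H) μA)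
    (π : ∀ w : Pl L, IrrClass ((UnitaryGroup.cmDatum L N H).Local w)) : Prop :=
  ∃ (P : DiscreteAutomorphicRep (adelicGroupData (↥(maximalRealSubfield L)) L (IsCMField.complexConj L) N H) μA)
    (W : Type) (_ : AddCommGroup W) (_ : Module ℂ W)
    (σf : Representation ℂ (finAdelic (↥(maximalRealSubfield L)) L (IsCMField.complexConj L) N H) W),
    DiscreteClass.mk P = c ∧ P.HasFinComponent σf ∧ HasLocalClasses L N H σf π

/-- **`LiesOver` — THE `b`-FREE FIBRE CONDITION AT A FINITE PLACE `w ≠ v`** («`π_w = ξ_H(ρ_w)`», p. 219 L3): `π_w` is `K_w`-SPHERICAL and its character satisfies the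
`Δ_w`-CHARACTER IDENTITY against `ρ_w` on matched bi-invariant pairs, `Tr π_w(φ) = Tr ρ_w(f^H)` whenever `f^H ∈ C_c(H_w⫽K_{H,w})`, `φ ∈ C_c(G_w⫽K_w)` and `φ → f^H` is a
`Δ_w`-transfer for the EXPLICIT factor.  By the fundamental lemma [§4.9 Prop. 4.9.1] the `Δ_w`-transfer of the spherical algebra is the dual `b` of `ξ̂_H` on Satake parameters
and regular stable orbital integrals separate it, so this identity IS `t(π)_w = ξ̂_H(t(ρ))_w` [§13.2] — with NO named dual map (`b`∕`t₀` as a free field would un-pin the cut: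
S10#1 F1 (iii)).  Its first conjunct is J-A∕HC-2's «non-zero `K^v`-fixed vector» clause.  (The measurable ∕ module structures are IMPLICIT binders,
read off the measures, orbital families and `ρw` by unification, so that sub-structure fields can be passed without instances in scope.) [cite: Rogawski1990, §13.8 p. 219 L3; §13.2 p. 197; §4.9 Prop. 4.9.1 p. 55] -/
def LiesOver (L : Type) [Field L] [NumberField L] [IsCMField L] (μ : HeckeCharacter L) (w : Pl L)
    {_msH : MeasurableSpace (HLoc L w)} {_msG : MeasurableSpace (Gqs L w)}
    {_qH : ∀ a : HLoc L w, MeasurableSpace (HLoc L w ⧸ Subgroup.centralizer ({a} : Set (HLoc L w)))}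
    {_qQ : ∀ γ : Gqs L w, MeasurableSpace (Gqs L w ⧸ Subgroup.centralizer ({γ} : Set (Gqs L w)))}
    (KG : Subgroup (Gqs L w)) (KHw : Subgroup (HLoc L w)) (νQw : Measure (Gqs L w)) (νHw : Measure (HLoc L w))
    (mHw : OrbitalMeasureFamily (HLoc L w)) (mQw : OrbitalMeasureFamily (Gqs L w))
    (πw : IrrClass (Gqs L w)) {Vw : Type} {_acV : AddCommGroup Vw} {_mdV : Module ℂ Vw} (ρw : Representation ℂ (HLoc L w) Vw) : Prop :=
  πw.IsSpherical KG ∧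
    ∀ (fH : HLoc L w → ℂ) (φ : Gqs L w → ℂ), IsLevel KHw fH → IsLevel KG φ → MatchE1 L μ w mHw mQw fH φ →
      πw.smoothTrace νQw φ = ρw.smoothTrace νHw fH

/-- **`xiReduce ν₁ χ f^H = (h₂ ↦ ∫_{U(Φ₁)_v} f^H(h₂, z) · χ(z) dν₁(z))`** — the `θ_v`-REDUCTION of a test function on `H_v = U(Φ₂)_v × U(Φ₁)_v` along the character `χ = θ_v`
of the `U(Φ₁)`-line: `Tr (ρ₂ ⊠ θ)_v(f^H) = Tr ρ_{2,v}(xiReduce ν₁ θ_v f^H)` (slot E2-a of FILE B's docstring, now TYPED; N3). [cite: Rogawski1990, §13.8 p. 219 L1–L2; §4.9 p. 54] -/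
def xiReduce {L : Type} [Field L] [NumberField L] [IsCMField L] {v : Pl L} [MeasurableSpace (H1Loc L v)]
    (ν₁ : Measure (H1Loc L v)) (χ : H1Loc L v → ℂ) (fH : HLoc L v → ℂ) : H2Loc L v → ℂ :=
  fun h₂ => ∫ z, fH (h₂, z) * χ z ∂ν₁

/-! ## §1 The global `H`-datum `ρ = ρ₂ ⊠ θ` and the archimedean measure convention -/

section Structures

variable (L : Type) [Field L] [NumberField L] [IsCMField L] [DecidableEq (Pl L)] (μ : HeckeCharacter L) (v : Pl L)
  [MeasurableSpace (HLoc L v)] [BorelSpace (HLoc L v)] [MeasurableSpace (Gqs L v)] [BorelSpace (Gqs L v)]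
  (νHv : Measure (HLoc L v)) (νQv : Measure (Gqs L v)) [νHv.IsHaarMeasure] [νHv.IsMulRightInvariant] [νQv.IsHaarMeasure] [νQv.IsMulRightInvariant]
  [∀ a : HLoc L v, MeasurableSpace (HLoc L v ⧸ Subgroup.centralizer ({a} : Set (HLoc L v)))]
  [∀ a : HLoc L v, BorelSpace (HLoc L v ⧸ Subgroup.centralizer ({a} : Set (HLoc L v)))]
  [∀ γ : Gqs L v, MeasurableSpace (Gqs L v ⧸ Subgroup.centralizer ({γ} : Set (Gqs L v)))]
  [∀ γ : Gqs L v, BorelSpace (Gqs L v ⧸ Subgroup.centralizer ({γ} : Set (Gqs L v)))]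
  (mHv : OrbitalMeasureFamily (HLoc L v)) (mQv : OrbitalMeasureFamily (Gqs L v)) (πSt : IrrClass (HLoc L v))
  [MeasurableSpace (G3 L).Adelic] [BorelSpace (G3 L).Adelic] [MeasurableSpace (H2 L).Adelic] [BorelSpace (H2 L).Adelic]
  [MeasurableSpace (GArch L)] [BorelSpace (GArch L)] [MeasurableSpace (HArch L)] [BorelSpace (HArch L)]
  [MeasurableSpace (H1Loc L v)] [MeasurableSpace (H1Arch L)] [MeasurableSpace (H1 L).Adelic] [BorelSpace (H1 L).Adelic]

/-- **THE GLOBAL `H`-DATUM OF (13.8.3)** — `ρ = ρ₂ ⊠ θ` cuspidal on `H = U(Φ₂) × U(Φ₁)` with (ii) `ρ_w` unramified off `v` and (iii) `ρ_v ∈ πSt` [p. 218 L9], as ONE primitive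
occurrence witness `PH` on ★ `cmDatum L 2 Φ₂` (ruling (f)) of multiplicity one [Thm. 11.5.1 (c) p. 165] × the automorphic `U(Φ₁)`-line `θ` (★ `cmOccursInDiscreteSpectrum`,
`N = 1`), the (B·_H) restricted-tensor data of ★ `flath_conjuncts_of_inputs_of_locSmooth` :95–:103 VERBATIM, and print's ARCHIMEDEAN MEASURE CONVENTION + the pinned factor
`Δ″_∞`.  PARAMETERS = the binders of ★ `Pinned1383Letter` the fields READ (`μ`, `v`, `νHv`, `νQv`, `mHv`, `mQv`, `πSt`), the letter's canonicity hypotheses :107–108 carried as the first two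
fields `hmHv`, `hmQv` over those parameters (audit (B-a); as Prop-valued structure PARAMETERS they make Lean's elaborator time out on `IsCanonical`, content identical) and the measurable structures FILE A supplies by `borel`. [cite: Rogawski1990, §13.8 Prop. 13.8.3 (proof) p. 218 L9; §1.7 p. 6; §4.3 p. 43] -/
structure S10HDatum : Type 1 where
  -- ═════════════ the letter's CANONICITY hypotheses at `v` (★ `Pinned1383Letter` :107–108), carried as fields over the PARAMETERS `mHv`, `mQv` (audit (B-a); F4∕J1) ═════════════
  /-- `mHv` is canonical w.r.t. `νHv` on the `G`-regular classes (★ `Pinned1383Letter` :107 `hmH`, fed in by FILE A verbatim). -/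
  hmHv : mHv.IsCanonical (IsLocalGRegular L v) νHv
  /-- `mQv` is canonical w.r.t. `νQv` on the regular classes (★ `Pinned1383Letter` :108 `hmQ`). -/
  hmQv : mQv.IsCanonical (fun γ => IsRegularElt (γ.val : GL (Fin 3) (UnitaryGroup.LocalRing L v))) νQv
  -- ═════════════ `ρ₂`: the `U(Φ₂)`-component as ONE primitive discrete witness on ★ `cmDatum L 2 Φ₂` [p. 218 L9; Thm. 11.5.1 (c) p. 165] ═════════════
  /-- the automorphic measure on `U(Φ₂)(L⁺)\U(Φ₂)(𝔸_{L⁺})`. -/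
  μH : Measure (H2 L).automorphicQuotient
  /-- it is an automorphic measure. -/
  [hμH : (H2 L).IsAutomorphicMeasure μH]
  /-- the Haar measure on `U(Φ₂)(𝔸_{L⁺})` computing `Tr ρ(f^H)` (★ `DiscreteClass.classTrace`). -/
  νH : Measure (H2 L).Adelic
  /-- it is a Haar measure. -/
  [hνH : νH.IsHaarMeasure]
  /-- THE primitive occurrence witness of `ρ₂` in the discrete spectrum of `U(Φ₂)` (audit (B-d): one primitive, everything else linked to it). -/
  PH : DiscreteAutomorphicRep (H2 L) μH
  /-- the local classes `ρ_{2,w}`. -/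
  ρ₂ : ∀ w : Pl L, IrrClass (H2Loc L w)
  /-- the finite-adelic space of `ρ₂^∞`. -/
  WfH : Type
  /-- its additive structure. -/
  [acWfH : AddCommGroup WfH]
  /-- its `ℂ`-module structure. -/
  [mdWfH : Module ℂ WfH]
  /-- `ρ₂^∞` as a representation of `U(Φ₂)(𝔸_f)`. -/
  σfH : Representation ℂ (finAdelic (↥(maximalRealSubfield L)) L (IsCMField.complexConj L) 2 (Matrix.of fun i j : Fin 2 => if i.val + j.val + 1 = 2 then (1 : L) else 0)) WfH
  /-- `ρ₂^∞` IS the finite component of `PH`. -/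
  hPσfH : PH.HasFinComponent σfH
  /-- … irreducible, smooth, admissible, with local constituents EXACTLY `ρ₂ w`. -/
  hσfH : HasLocalClasses L 2 (Matrix.of fun i j : Fin 2 => if i.val + j.val + 1 = 2 then (1 : L) else 0) σfH ρ₂
  -- ═════════════ THE `H`-SIDE CUT = THE FULL `t(ρ)`-FIBRE = the automorphic members of the packet `Π(ρ)` (AUDIT S10#5 F6) [Prop. 11.2.1 (a) p. 161; Thm. 11.5.1 (c) p. 165; p. 170 (5)] ═════════════
  /-- the index of the packet cut (`2^{#real places}` members differing at `∞`). -/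
  J : Type
  /-- the packet cut is FINITE. -/
  hJ : Finite J
  /-- the members of the packet cut as discrete classes of `U(Φ₂)`. -/
  dρ : J → DiscreteClass (H2 L) μH
  /-- no member counted twice. -/
  hinjH : Function.Injective dρ
  /-- the primitive witness is a member. -/
  hPHmem : DiscreteClass.mk PH ∈ Set.range dρ
  /-- every member has the finite local classes `ρ₂ w` (members differ only at `∞`). -/
  hlinkH : ∀ j, IsLinked L 2 (Matrix.of fun i j : Fin 2 => if i.val + j.val + 1 = 2 then (1 : L) else 0) μH (dρ j) ρ₂
  /-- `n(ρ) = 1`: every member occurs with multiplicity one [Prop. 11.2.1 (a) p. 161 + Thm. 11.5.1 (c) p. 165] — so `Σ_j m_j Tr ρ_j(f^H)` IS print's packet trace `Tr ρ(f^H)`. -/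
  hdρ : ∀ j, (dρ j).mult = 1
  /-- EXHAUSTIVENESS on `H` (frozen-vector-FREE): every discrete class of `U(Φ₂)` with the finite local classes of `ρ` lies in the packet cut (strong multiplicity one for
  `L`-packets on `U(2)` [Thm. 11.5.1 p. 165; §13.3]; zero-trace members are harmless in a `∑ᶠ`). -/
  hexhH : ∀ d : DiscreteClass (H2 L) μH, IsLinked L 2 (Matrix.of fun i j : Fin 2 => if i.val + j.val + 1 = 2 then (1 : L) else 0) μH d ρ₂ → d ∈ Set.range dρ
  -- ═════════════ `θ`: the automorphic `U(Φ₁)`-line, with its character at `v` PINNED by the trace (E2-a) ═════════════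
  /-- the automorphic measure on `U(Φ₁)(L⁺)\U(Φ₁)(𝔸_{L⁺})`. -/
  μ₁ : Measure (H1 L).automorphicQuotient
  /-- it is an automorphic measure. -/
  [hμ₁ : (H1 L).IsAutomorphicMeasure μ₁]
  /-- the local classes of `θ`. -/
  θ : ∀ w : Pl L, IrrClass (H1Loc L w)
  /-- `θ` OCCURS in the discrete spectrum of `U(Φ₁)` (global automorphy of the line). -/
  hθ : cmOccursInDiscreteSpectrum L 1 (Matrix.of fun i j : Fin 1 => if i.val + j.val + 1 = 1 then (1 : L) else 0) μ₁ θ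
  /-- a Haar measure on `U(Φ₁)(L⁺_v)` (the `dz` of the `θ_v`-reduction). -/
  ν₁v : Measure (H1Loc L v)
  /-- the character `θ_v : U(Φ₁)(L⁺_v) → ℂ` as a function. -/
  χv : H1Loc L v → ℂ
  /-- PIN: `θ_v` IS the class of the character `χv` — its distribution character against `ν₁v` is integration against `χv` on locally smooth test functions. -/
  hχv : ∀ f₁ : H1Loc L v → ℂ, IsLocSmooth f₁ → (θ v).smoothTrace ν₁v f₁ = ∫ z, f₁ z * χv z ∂ν₁v
  -- ═════════════ (B·_H) the restricted-tensor data of `ρ = ρ₂ ⊠ θ` (★ :95–:103 VERBATIM) + the factor links + `hpin` ═════════════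
  /-- the unit levels `K_{H,w} ≤ H_w`. -/
  KH : ∀ w : Pl L, Subgroup (HLoc L w)
  /-- they are open. -/
  [hKHo : Fact (∀ w, IsOpen (KH w : Set (HLoc L w)))]
  /-- they are compact. -/
  hKHc : ∀ w, IsCompact (KH w : Set (HLoc L w))
  /-- the unit levels of the `U(Φ₂)`-factor. -/
  K₂ : ∀ w : Pl L, Subgroup (H2Loc L w)
  /-- the unit levels of the `U(Φ₁)`-factor. -/
  K₁ : ∀ w : Pl L, Subgroup (H1Loc L w)
  /-- `K_{H,w} = K_{2,w} × K_{1,w}`. -/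
  hKH : ∀ w, KH w = (K₂ w).prod (K₁ w)
  /-- off `v` the `U(Φ₂)`-levels are the STANDARD integral levels `U(Φ₂)(𝒪_w)` (★ `cmLocalIntegralLevel`; AUDIT S10#5 N6) [p. 218 L9 (ii), p. 219 L2]. -/
  hK₂std : ∀ w, w ≠ v → K₂ w = cmLocalIntegralLevel L 2 (Matrix.of fun i j : Fin 2 => if i.val + j.val + 1 = 2 then (1 : L) else 0) w
  /-- off `v` the `U(Φ₁)`-levels are the standard integral levels `U(Φ₁)(𝒪_w)`. -/
  hK₁std : ∀ w, w ≠ v → K₁ w = cmLocalIntegralLevel L 1 (Matrix.of fun i j : Fin 1 => if i.val + j.val + 1 = 1 then (1 : L) else 0) w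
  /-- the measurable structure of `Πʳ_w H_w`. -/
  [msFH : MeasurableSpace (Πʳ w : Pl L, [HLoc L w, KH w])]
  /-- it is the Borel structure. -/
  [bsFH : BorelSpace (Πʳ w : Pl L, [HLoc L w, KH w])]
  /-- the finite-adelic Haar measure on `H`. -/
  νfH : Measure (Πʳ w : Pl L, [HLoc L w, KH w])
  /-- it is left invariant. -/
  [hνfHl : νfH.IsMulLeftInvariant]
  /-- it is finite on compacts. -/
  [hνfHc : IsFiniteMeasureOnCompacts νfH]
  /-- (B4_H) Tate's normalisation on `H`: `ν_{H,f}(K′ × Π_{w ≠ v} K_{H,w}) = νHv(K′)`. -/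
  hνfH : ∀ K' : Subgroup (HLoc L v), IsOpen (K' : Set (HLoc L v)) → IsCompact (K' : Set (HLoc L v)) →
    νfH.real {g : Πʳ w : Pl L, [HLoc L w, KH w] | g v ∈ K' ∧ ∀ w, w ≠ v → g w ∈ KH w} = νHv.real (K' : Set (HLoc L v))
  /-- the local spaces of `ρ`. -/
  V : Pl L → Type
  /-- their additive structure. -/
  [acV : ∀ w, AddCommGroup (V w)]
  /-- their `ℂ`-module structure. -/
  [mdV : ∀ w, Module ℂ (V w)]
  /-- the local factors `ρ_w` as representations of `H_w = U(Φ₂)(L⁺_w) × U(Φ₁)(L⁺_w)`. -/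
  ρ : ∀ w, Representation ℂ (HLoc L w) (V w)
  /-- the distinguished vectors. -/
  x₀ : ∀ w, V w
  /-- the finite-adelic space of `ρ^∞`. -/
  W : Type
  /-- its additive structure. -/
  [acW : AddCommGroup W]
  /-- its `ℂ`-module structure. -/
  [mdW : Module ℂ W]
  /-- `ρ^∞` as a representation of `Πʳ_w H_w`. -/
  σH : Representation ℂ (Πʳ w : Pl L, [HLoc L w, KH w]) W
  /-- the distinguished vectors are fixed almost everywhere. -/
  hx₀ : ∀ᶠ w in cofinite, x₀ w ∈ (ρ w).fixedPoints (KH w)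
  /-- the factorisation map. -/
  j : RestrictedFamily V x₀ → W
  /-- the exceptional set. -/
  S₀ : Finset (Pl L)
  /-- `ρ^∞ ≅ ⊗'_w ρ_w`. [cite: FlathCorvallis1979, Thm. 3] -/
  hσH : IsRestrictedTensorProductRep ρ σH hx₀ j S₀
  /-- (ii) p. 218 L9: `ρ` is unramified off `v`. -/
  hS₀ : S₀ ⊆ {v}
  /-- off `v` the `K_{H,w}`-fixed space of `ρ_w` is a LINE. -/
  hline : ∀ w, w ≠ v → (ρ w).fixedPoints (KH w) = ℂ ∙ x₀ w
  /-- the local factors are admissible. -/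
  hadm : ∀ w, (ρ w).IsAdmissible
  /-- FACTOR LINK: `ρ_w|_{U(Φ₂)}` lies in the class `ρ₂ w` … -/
  hfac₂ : ∀ w, (ρ₂ w).IsConstituentOf ((ρ w).comp (MonoidHom.inl _ _))
  /-- … and `ρ_w|_{U(Φ₁)}` lies in the class `θ w` (so `ρ = ρ₂ ⊠ θ` is GLOBALLY automorphic on `H`). -/
  hfac₁ : ∀ w, (θ w).IsConstituentOf ((ρ w).comp (MonoidHom.inr _ _))
  /-- (iii) p. 218 L9 ∕ the letter's label at `v`: `ρ_v` has the character of `πSt` (★ :107 `hpin`). -/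
  hpin : πSt.smoothTrace νHv = (ρ v).smoothTrace νHv
  -- ═════════════ PRINT'S ARCHIMEDEAN MEASURE CONVENTION [§1.7 p. 6; §4.3 (4.3.1) p. 43] (S10#E E-F1 (b), E-F2: NOT ★ `IsCanonical` at ∞) + the pinned `Δ″_∞` ═════════════
  /-- the Haar measure `dg_∞` on `G_∞`. -/
  νGi : Measure (GArch L)
  /-- it is a Haar measure. -/
  [hνGi : νGi.IsHaarMeasure]
  /-- it is right invariant (unimodularity). -/
  [hνGir : νGi.IsMulRightInvariant]
  /-- the Haar measure `dh_∞` on `H_∞`. -/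
  νHi : Measure (HArch L)
  /-- it is a Haar measure. -/
  [hνHi : νHi.IsHaarMeasure]
  /-- it is right invariant. -/
  [hνHir : νHi.IsMulRightInvariant]
  /-- the torus measures `dt` on the centralisers of `G_∞` (a datum, as in print). -/
  tGi : ∀ γ : GArch L, Measure (Subgroup.centralizer ({γ} : Set (GArch L)))
  /-- the torus measures `dt_H` on the centralisers of `H_∞`. -/
  tHi : ∀ a : HArch L, Measure (Subgroup.centralizer ({a} : Set (HArch L)))
  /-- the archimedean orbital measure family on `G_∞` (Borel quotient structures). -/
  mGi : ArchOrbFamG L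
  /-- the archimedean orbital measure family on `H_∞`. -/
  mHi : ArchOrbFamH L
  /-- (W) WEIL FORM on `G_∞`: at every regular class `m_∞ = dg_∞ ∕ dt` (★ `IsQuotientOf`). -/
  hWG : letI : ∀ γ : GArch L, MeasurableSpace (GArch L ⧸ Subgroup.centralizer ({γ} : Set (GArch L))) := fun _ => borel _
    haveI : ∀ γ : GArch L, BorelSpace (GArch L ⧸ Subgroup.centralizer ({γ} : Set (GArch L))) := fun _ => ⟨rfl⟩
    mGi.IsQuotientOf (fun γ => IsRegularElt (γ.val : GL (Fin 3) (mixedEmbedding.mixedSpace L))) νGi tGi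
  /-- (W_H)+(C_H) on `H_∞`: Weil form at the `G`-regular classes and transport of `dt_H` to `dt` along `ι_∞` (★ `ArchCompatibleFamiliesH`, [LanglandsShelstad1987 (1.4)]). -/
  hWH : ArchCompatibleFamiliesH L νHi mHi tHi tGi
  -- ═════════════ THE ARCHIMEDEAN PACKET REPRESENTATION `ρ_∞` OF `ρ` (FILE E's currency: a unitary representation of `H_∞` on a Hilbert space; `= 𝔞.ρH` at ED. 2) [p. 218 L9 (i), L11–L18] ═════════════
  /-- the Hilbert space of `ρ_∞`. -/
  EH : Type
  /-- its normed group structure. -/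
  [nacgEH : NormedAddCommGroup EH]
  /-- its inner product structure. -/
  [ipsEH : InnerProductSpace ℂ EH]
  /-- it is complete. -/
  [csEH : CompleteSpace EH]
  /-- `ρ_∞`, the archimedean component of the PACKET `Π(ρ)` («ρ_v is a discrete series L-packet on H_v», p. 218 L9 (i)) as a continuous representation of `H_∞`. -/
  ρi : ContRepresentation ℂ (HArch L) EH
  /-- `ρ_∞` is unitary. -/
  hui : ρi.IsUnitary
  /-- `ρ_∞` is strongly continuous. -/
  hsci : ρi.IsStronglyContinuous
  /-- a Haar measure on `U(Φ₁)(L⁺ ⊗ ℝ)` (the `dz` of the `θ_∞`-reduction). -/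
  ν₁i : Measure (H1Arch L)
  /-- the archimedean character `θ_∞ : U(Φ₁)(L⁺ ⊗ ℝ) → ℂ` of the line as a function … -/
  χi : H1Arch L → ℂ
  /-- … a Haar measure on `U(Φ₁)(𝔸)` … -/
  ν₁ : Measure (H1 L).Adelic
  /-- … which is one. -/
  [hν₁ : ν₁.IsHaarMeasure]
  /-- … THE automorphic line `θ` as a discrete class of `U(Φ₁)` … -/
  d₁ : DiscreteClass (H1 L) μ₁
  /-- … with local classes `θ w` everywhere (sharpens `hθ`) … -/
  hlink₁ : IsLinked L 1 (Matrix.of fun i j : Fin 1 => if i.val + j.val + 1 = 1 then (1 : L) else 0) μ₁ d₁ θ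
  /-- … occurring once (multiplicity one on `U(1)`) … -/
  hd₁ : d₁.mult = 1
  /-- … and `χi` PINNED TO `θ_∞` by the global–archimedean Flath split on `U(Φ₁)` (AUDIT S10#6 F7; without it `χi` — hence `ρi`'s `U(Φ₁)_∞`-factor — would be free and B1 FALSE):
  for every smooth `g_∞`, smooth `g_v` and freezing map `Φ₁` pinned pointwise to `g_∞ ⊗ g_v ⊗ 𝟙_{K_1^v}`: `Tr θ(Φ₁ g_v) = m(θ) · (∫ g_∞ θ_∞ dν₁i) · Tr θ_v(g_v)` (orientation = `hfHi₂`'s).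
  [cite: FlathCorvallis1979, Thm. 3] [cite: Rogawski1990, §13.8 p. 219 L1–L2] -/
  hθi : ∀ (gi : H1Arch L → ℂ) (gv : H1Loc L v → ℂ), ArchSmooth L 1 (Matrix.of fun i j : Fin 1 => if i.val + j.val + 1 = 1 then (1 : L) else 0) gi → IsLocSmooth gv →
    ∀ (Φ₁ : (H1Loc L v → ℂ) → C_c((H1 L).Adelic, ℂ)),
      (∀ g₁ : H1Loc L v → ℂ, IsLocSmooth g₁ → ∀ z : (H1 L).Adelic,
        Φ₁ g₁ z = gi (UnitaryGroup.archPart (↥(maximalRealSubfield L)) L (IsCMField.complexConj L) 1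
            (Matrix.of fun i j : Fin 1 => if i.val + j.val + 1 = 1 then (1 : L) else 0) z) *
          (g₁ ((H1 L).toLocal v z) *
            ∏ᶠ w : {w : Pl L // w ≠ v}, Set.indicator (K₁ w.1 : Set (H1Loc L w.1)) (fun _ => (1 : ℂ)) ((H1 L).toLocal w.1 z))) →
      d₁.classTrace ν₁ (Φ₁ gv) = ((d₁.mult).toNat : ℂ) * (∫ z, gi z * χi z ∂ν₁i) * (θ v).smoothTrace ν₁v gv
  -- ═════════════ THE ARCHIMEDEAN EXISTENCE CLAUSE (plan RECONCILED RULING 16:09:43Z (i); bodies = FILE E's E-D1∕E-D2 VERBATIM, H-side in ★ `HasArchOpTrace` currency) ═════════════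
  /-- (i) p. 218 L9 + L11–L28 AS ONE EXISTENCE CLAUSE: there ARE archimedean components `f_∞ ∈ C_c^∞(G_∞)`, `f^H_∞ ∈ C_c^∞(H_∞)` with `f_∞ → f^H_∞` a `Δ″_∞`-transfer at the
  factor of record, `f_∞` STABLY NULL, the PACKET trace `Θ_{ρ_∞}(f^H_∞) = 2` [p. 218 L22 × L26], and `Θ_ϖ(f_∞) ∈ {0, 1, −1}` for every irreducible unitary `ϖ` of `G_∞` [L24, L28]
  — so that `S10Frozen 𝔥` (which re-posits these as FIELDS of the frozen vector) is inhabited for every datum.  Payer (A2a): 5R⁺ globalisation prescribing the archimedean type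
  [Langlands L₁ p. 227] + FILE E's kit (`ArchSignKit.hasArchOpTrace_two`, `isArchSignTest_frozenG`) [Prop. 12.3.2] + Shelstad's archimedean transfer (E5, S6). -/
  harch : ∃ (fG : C_c(GArch L, ℂ)) (fH : C_c(HArch L, ℂ)), ArchSmooth L 3 (phi3 L) ⇑fG ∧ ArchSmooth₂ L ⇑fH ∧
    IsArchDeltaTransfer (_ha := fun _ => borel _) (_hγ := fun _ => borel _) L (phi3 L) (archDeltaPP L μ) mHi mGi ⇑fH ⇑fG ∧
    IsArchStablyNull L mGi ⇑fG ∧ HasArchOpTrace νHi ρi hui hsci fH 2 ∧ IsArchSignTest νGi fG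
  /-- **THE LINK LAW «GLOBAL–ARCHIMEDEAN FLATH SPLIT OVER THE PACKET CUT»** (ties `ρi` to the automorphic packet `dρ`; typ4's call under the reconciled ruling, flagged): for every
  smooth `F^H ∈ C_c^∞(H_∞)` with `Θ_{ρ_∞}(F^H) = c`, its `θ_∞`-reduction `F₂(h₂) = ∫ F^H(h₂, z) θ_∞(z) dz`, and every freezing map `Φ` PINNED POINTWISE to `F₂ ⊗ (f^H)_{v,θ} ⊗ 𝟙_{K_2^v}`
  (the body of `S10Frozen.hΦH` token for token): on matched pairs `Σ_j m_j · Tr ρ_j(Φ f^H) = c · Tr ρ^∞(f^H ⊗ 𝟙_{K_H^v})` — Flath for each member [FlathCorvallis1979, Thm. 3] ⊗ «every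
  member of `Π(ρ)` is automorphic with `n(ρ) = 1`» [Prop. 11.2.1 (a) p. 161; Thm. 11.5.1 (c) p. 165; §13.3] ⊗ the `θ`-reductions [p. 219 L1–L2] (compatible Haar normalisations of `νH`,
  `νHi`, `ν₁i`, `νfH` are part of the datum).  WITHOUT it a datum with an unrelated `ρi` would make the `H`-side split FALSE downstream; WITH it (B1_H)+«`aH = 2`» are the READ-OFF
  `S10Frozen.hsplitH_two`.  Payer (A2a). [cite: Rogawski1990, §13.8 p. 218 L22–L26, p. 219 L1–L3; §11.2 Prop. 11.2.1 (a) p. 161; Thm. 11.5.1 (c) p. 165] [cite: FlathCorvallis1979, Thm. 3] -/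
  hpacki : ∀ (FH : C_c(HArch L, ℂ)) (c : ℂ), ArchSmooth₂ L ⇑FH → HasArchOpTrace νHi ρi hui hsci FH c →
    ∀ (F₂ : H2Arch L → ℂ), (∀ h₂ : H2Arch L, F₂ h₂ = ∫ z, FH (h₂, z) * χi z ∂ν₁i) →
    ∀ (Φ : (HLoc L v → ℂ) → C_c((H2 L).Adelic, ℂ)),
      (∀ fH : HLoc L v → ℂ, IsLocSmooth fH → ∀ h : (H2 L).Adelic,
        Φ fH h = F₂ (UnitaryGroup.archPart (↥(maximalRealSubfield L)) L (IsCMField.complexConj L) 2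
            (Matrix.of fun i j : Fin 2 => if i.val + j.val + 1 = 2 then (1 : L) else 0) h) *
          (xiReduce ν₁v χv fH ((H2 L).toLocal v h) *
            ∏ᶠ w : {w : Pl L // w ≠ v}, Set.indicator (K₂ w.1 : Set (H2Loc L w.1)) (fun _ => (1 : ℂ)) ((H2 L).toLocal w.1 h))) →
    ∀ (fH : HLoc L v → ℂ) (φ : Gqs L v → ℂ), MatchE1 L μ v mHv mQv fH φ →
      ∑ᶠ j, (((dρ j).mult).toNat : ℂ) * (dρ j).classTrace νH (Φ fH) =
        c * σH.smoothTrace νfH (fun g : Πʳ w : Pl L, [HLoc L w, KH w] => fH (g v) *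
          Set.indicator {g : Πʳ w : Pl L, [HLoc L w, KH w] | ∀ w, w ≠ v → g w ∈ KH w} (fun _ => (1 : ℂ)) g)

/-! ## §2 The frozen vectors and the off-`v` pins -/

/-- **THE FROZEN VECTORS OF (13.8.3)** given the `H`-datum `𝔥`: the `U(Φ₃)`-levels `K_w` and the finite-adelic Haar data (B4), the archimedean components `f_∞` (N1: STABLY NULL —
E-D1 body; sign test E-D2 body) and `f^H_∞` (packet trace `2`) with `f_∞ → f^H_∞` a `Δ″_∞`-transfer at `archDeltaPP L μ`, the freezing maps `ΦG φ = f_∞ ⊗ φ ⊗ 𝟙_{K^v}` and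
`ΦH f^H = f^H_{∞,θ} ⊗ (f^H)_{v,θ} ⊗ 𝟙_{K_2^v}` PINNED POINTWISE, and the OFF-`v` pins (per-place Haar with `vol(K_w) = 1`, CANONICAL orbital families, unit ↔ unit transfers).
[cite: Rogawski1990, §13.8 p. 218 L20–L28, p. 219 L2; §4.9 Prop. 4.9.1 p. 55] -/
structure S10Frozen (𝔥 : S10HDatum L μ v νHv νQv mHv mQv πSt) : Type 1 where
  -- ═════════════ the `U(Φ₃)`-levels and the finite-adelic Haar data (★ :80–:85 VERBATIM) ═════════════
  /-- the unit levels `K_w ≤ U(Φ₃)(L⁺_w)` of the frozen vector (`f_w = 𝟙_{K_w}` off `v`). -/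
  K : ∀ w : Pl L, Subgroup (Gqs L w)
  /-- the levels are open. -/
  [hKo : Fact (∀ w, IsOpen (K w : Set (Gqs L w)))]
  /-- the levels are compact. -/
  hKc : ∀ w, IsCompact (K w : Set (Gqs L w))
  /-- off `v` the levels are the STANDARD integral levels `U(Φ₃)(𝒪_w)` (★ `cmLocalIntegralLevel`; AUDIT S10#5 N6) [p. 219 L2 `f^{u,v′}` = unit of a hyperspecial]. -/
  hKstd : ∀ w, w ≠ v → K w = cmLocalIntegralLevel L 3 (qsForm L) w
  /-- the measurable structure of `Πʳ_w U(Φ₃)(L⁺_w)`. -/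
  [msF : MeasurableSpace (Πʳ w : Pl L, [Gqs L w, K w])]
  /-- it is the Borel structure. -/
  [bsF : BorelSpace (Πʳ w : Pl L, [Gqs L w, K w])]
  /-- the finite-adelic Haar measure `ν_f`. -/
  νf : Measure (Πʳ w : Pl L, [Gqs L w, K w])
  /-- `ν_f` is left invariant. -/
  [hνfl : νf.IsMulLeftInvariant]
  /-- `ν_f` is finite on compacts. -/
  [hνfc : IsFiniteMeasureOnCompacts νf]
  /-- (B4) Tate's normalisation `ν_f(K′ × Π_{w ≠ v} K_w) = νQv(K′)` (F1 (i) on the `G` side). -/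
  hνf : ∀ K' : Subgroup (Gqs L v), IsOpen (K' : Set (Gqs L v)) → IsCompact (K' : Set (Gqs L v)) →
    νf.real {g : Πʳ w : Pl L, [Gqs L w, K w] | g v ∈ K' ∧ ∀ w, w ≠ v → g w ∈ K w} = νQv.real (K' : Set (Gqs L v))
  -- ═════════════ the archimedean components [p. 218 L20–L28] ═════════════
  /-- `f_∞ ∈ C_c(G_∞)` [p. 218 L20 «f_u = f_{π⁺} − f_{π⁻}» ⊗ the other archimedean components] (E2-E: `= 𝔥.𝔞.frozenG` once FILE E is in the tree). -/
  fGi : C_c(GArch L, ℂ)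
  /-- `f_∞` is smooth (★ `ArchSmooth`, E's test class). -/
  hsmG : ArchSmooth L 3 (phi3 L) ⇑fGi
  /-- N1 «`f_∞` STABLY NULL»: every regular stable orbital integral of `f_∞` vanishes [p. 218 L20–L21; §4.1 (4.1.1)] — FILE E's (E-D1) body (`IsArchStablyNull`). -/
  hSO : IsArchStablyNull L 𝔥.mGi ⇑fGi
  /-- `Θ_ϖ(f_∞) ∈ {0, 1, −1}` for every irreducible unitary `ϖ` of `G_∞` [p. 218 L24, L28] — FILE E's (E-D2) body (`IsArchSignTest`; E2-E: ★ `ArchSignKit.isArchSignTest_frozenG`). -/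
  htrG : haveI := 𝔥.hνGi; IsArchSignTest 𝔥.νGi fGi
  /-- `f_∞^H ∈ C_c(H_∞)` [p. 218 L23–L25]. -/
  fHi : C_c(HArch L, ℂ)
  /-- `f_∞^H` is smooth (★ `ArchSmooth₂`). -/
  hsmH : ArchSmooth₂ L ⇑fHi
  /-- `f_∞ → f_∞^H` is a `Δ″_∞`-transfer at the factor of record (★ `IsArchDeltaTransfer` at `archDeltaPP L μ`) [§14.3 pp. 233–234; p. 218 L23]. -/
  harch : IsArchDeltaTransfer (_ha := fun _ => borel _) (_hγ := fun _ => borel _) L (phi3 L) (archDeltaPP L μ) 𝔥.mHi 𝔥.mGi ⇑fHi ⇑fGi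
  /-- THE PACKET TRACE `Θ_{ρ_∞}(f^H_∞) = 2` [p. 218 L22 «Tr ρ_u(f_u^H) = 2» × L26 «= 1» at the other real places] (★ `HasArchOpTrace` currency, structures implicit; E2-E: ★
  `ArchSignKit.hasArchOpTrace_two`). -/
  htrH : haveI := 𝔥.hνHi; HasArchOpTraceI 𝔥.νHi 𝔥.ρi 𝔥.hui 𝔥.hsci fHi 2
  /-- the `θ_∞`-reduced archimedean component of `f^H_∞` on `U(Φ₂)(L⁺ ⊗ ℝ)` (NAMED) … -/
  fHi₂ : H2Arch L → ℂ
  /-- … PINNED: `fHi₂ h₂ = ∫_{U(Φ₁)_∞} f^H_∞(h₂, z) θ_∞(z) dν₁i(z)` (E2-a at `∞`, typed). -/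
  hfHi₂ : ∀ h₂ : H2Arch L, fHi₂ h₂ = ∫ z, fHi (h₂, z) * 𝔥.χi z ∂𝔥.ν₁i
  -- ═════════════ the freezing maps, PINNED POINTWISE (F1 (ii)) [p. 218 L24 «f = f_u × f_{v′} × f^{u,v′}», p. 219 L2] ═════════════
  /-- `φ ↦ f = f_∞ ⊗ φ ⊗ 𝟙_{K^v}` as a compactly supported function on `U(Φ₃)(𝔸_{L⁺})`. -/
  ΦG : (Gqs L v → ℂ) → C_c((G3 L).Adelic, ℂ)
  /-- the POINTWISE pin of `ΦG` on locally smooth `φ`: `ΦG φ (g) = f_∞(g_∞) · φ(g_v) · Π_{w ≠ v} 𝟙_{K_w}(g_w)` (★ `archPart`, ★ `toLocal`). -/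
  hΦG : ∀ φ : Gqs L v → ℂ, IsLocSmooth φ → ∀ g : (G3 L).Adelic,
    ΦG φ g = fGi (UnitaryGroup.archPart (↥(maximalRealSubfield L)) L (IsCMField.complexConj L) 3 (qsForm L) g) *
      (φ ((G3 L).toLocal v g) * ∏ᶠ w : {w : Pl L // w ≠ v}, Set.indicator (K w.1 : Set (Gqs L w.1)) (fun _ => (1 : ℂ)) ((G3 L).toLocal w.1 g))
  /-- `f^H ↦ f^H_{∞,θ} ⊗ (f^H)_{v,θ} ⊗ 𝟙_{K_2^v}` as a compactly supported function on `U(Φ₂)(𝔸_{L⁺})`. -/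
  ΦH : (HLoc L v → ℂ) → C_c((H2 L).Adelic, ℂ)
  /-- the POINTWISE pin of `ΦH` on locally smooth `f^H`, through the TYPED `θ_v`-reduction `xiReduce 𝔥.ν₁v 𝔥.χv` (N3, E2-a). -/
  hΦH : ∀ fH : HLoc L v → ℂ, IsLocSmooth fH → ∀ h : (H2 L).Adelic,
    ΦH fH h = fHi₂ (UnitaryGroup.archPart (↥(maximalRealSubfield L)) L (IsCMField.complexConj L) 2
        (Matrix.of fun i j : Fin 2 => if i.val + j.val + 1 = 2 then (1 : L) else 0) h) *
      (xiReduce 𝔥.ν₁v 𝔥.χv fH ((H2 L).toLocal v h) *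
        ∏ᶠ w : {w : Pl L // w ≠ v}, Set.indicator (𝔥.K₂ w.1 : Set (H2Loc L w.1)) (fun _ => (1 : ℂ)) ((H2 L).toLocal w.1 h))
  -- ═════════════ the OFF-`v` PINS on `{w // w ≠ v}` (F1 (i)–(iv), N2): measures, canonical orbital families, unit transfers ═════════════
  /-- measurable structures on `U(Φ₃)(L⁺_w)`, `w ≠ v`. -/
  [msG : ∀ w : {w : Pl L // w ≠ v}, MeasurableSpace (Gqs L w.1)]
  /-- they are Borel. -/
  [bsG : ∀ w : {w : Pl L // w ≠ v}, BorelSpace (Gqs L w.1)]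
  /-- the local Haar measures `dg_w`, `w ≠ v`. -/
  νQ : ∀ w : {w : Pl L // w ≠ v}, Measure (Gqs L w.1)
  /-- they are Haar measures. -/
  [hνQ : ∀ w : {w : Pl L // w ≠ v}, (νQ w).IsHaarMeasure]
  /-- they are right invariant (unimodularity; needed by ★ `IsCanonical`). -/
  [hνQr : ∀ w : {w : Pl L // w ≠ v}, (νQ w).IsMulRightInvariant]
  /-- normalisation `vol(K_w) = 1` (F1 (i): `Tr π_w(𝟙_{K_w}) = 1` on the spherical line). -/
  hνQK : ∀ w : {w : Pl L // w ≠ v}, (νQ w).real (K w.1 : Set (Gqs L w.1)) = 1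
  /-- measurable structures of the centraliser quotients of `U(Φ₃)(L⁺_w)`. -/
  [qQ : ∀ (w : {w : Pl L // w ≠ v}) (γ : Gqs L w.1), MeasurableSpace (Gqs L w.1 ⧸ Subgroup.centralizer ({γ} : Set (Gqs L w.1)))]
  /-- they are Borel. -/
  [bqQ : ∀ (w : {w : Pl L // w ≠ v}) (γ : Gqs L w.1), BorelSpace (Gqs L w.1 ⧸ Subgroup.centralizer ({γ} : Set (Gqs L w.1)))]
  /-- the orbital measure families on `U(Φ₃)(L⁺_w)`, `w ≠ v`. -/
  mQ : ∀ w : {w : Pl L // w ≠ v}, OrbitalMeasureFamily (Gqs L w.1)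
  /-- … CANONICAL w.r.t. `dg_w` on the regular classes (★ `IsCanonical`, as at `v`). -/
  hmQ : ∀ w : {w : Pl L // w ≠ v}, (mQ w).IsCanonical (fun γ => IsRegularElt (γ.val : GL (Fin 3) (UnitaryGroup.LocalRing L w.1))) (νQ w)
  /-- measurable structures on `H_w`, `w ≠ v`. -/
  [msH : ∀ w : {w : Pl L // w ≠ v}, MeasurableSpace (HLoc L w.1)]
  /-- they are Borel. -/
  [bsH : ∀ w : {w : Pl L // w ≠ v}, BorelSpace (HLoc L w.1)]
  /-- the local Haar measures `dh_w`, `w ≠ v`. -/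
  νHw : ∀ w : {w : Pl L // w ≠ v}, Measure (HLoc L w.1)
  /-- they are Haar measures. -/
  [hνHw : ∀ w : {w : Pl L // w ≠ v}, (νHw w).IsHaarMeasure]
  /-- they are right invariant. -/
  [hνHwr : ∀ w : {w : Pl L // w ≠ v}, (νHw w).IsMulRightInvariant]
  /-- normalisation `vol(K_{H,w}) = 1`. -/
  hνHK : ∀ w : {w : Pl L // w ≠ v}, (νHw w).real (𝔥.KH w.1 : Set (HLoc L w.1)) = 1
  /-- measurable structures of the centraliser quotients of `H_w`. -/
  [qH : ∀ (w : {w : Pl L // w ≠ v}) (a : HLoc L w.1), MeasurableSpace (HLoc L w.1 ⧸ Subgroup.centralizer ({a} : Set (HLoc L w.1)))]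
  /-- they are Borel. -/
  [bqH : ∀ (w : {w : Pl L // w ≠ v}) (a : HLoc L w.1), BorelSpace (HLoc L w.1 ⧸ Subgroup.centralizer ({a} : Set (HLoc L w.1)))]
  /-- the orbital measure families on `H_w`, `w ≠ v`. -/
  mH : ∀ w : {w : Pl L // w ≠ v}, OrbitalMeasureFamily (HLoc L w.1)
  /-- … CANONICAL w.r.t. `dh_w` on the `G`-regular classes. -/
  hmH : ∀ w : {w : Pl L // w ≠ v}, (mH w).IsCanonical (IsLocalGRegular L w.1) (νHw w)
  /-- F1 (ii) «unit ↔ unit»: off `v` the frozen components `𝟙_{K_w} → 𝟙_{K_{H,w}}` ARE `Δ_w`-transfers for the explicit factor [§4.9 Prop. 4.9.1 p. 55 (fundamental lemma for the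
  unit); p. 219 L2]. -/
  htrf : ∀ w : {w : Pl L // w ≠ v}, IsLocalDeltaTransfer L (qsForm L) w.1 ((finExplicitCollection L (qsForm L) μ (finExplicitDelta_conj_left_all L (qsForm L) μ)
      (finExplicitDelta_conj_right_all L (qsForm L) μ)) w.1) (mH w) (mQ w)
    (Set.indicator (𝔥.KH w.1 : Set (HLoc L w.1)) (fun _ => (1 : ℂ))) (Set.indicator (K w.1 : Set (Gqs L w.1)) (fun _ => (1 : ℂ)))

/-! ## §4 The `G`-side cut: core ⊂ cut (J-A∕HC-1 (a)), countable ((β)), one primitive per member ((B-d)), the fibre (R1) -/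

/-- **`S10MemG 𝔥 𝔳 μG c πc` — THE ONE MEMBERSHIP PREDICATE OF THE `G`-SIDE CUT** (audit R1): the discrete class `c` of `U(Φ₃)` has local classes `πc` (★ `IsLinked`) and LIES OVER
`ρ_w` at every finite `w ≠ v` (`LiesOver`: `K_w`-spherical + the spherical `Δ_w`-character identity).  Used token-identically by `hexh` (hypothesis side); members satisfy it by
`S10GCutCore.memG`. [cite: Rogawski1990, §13.8 (13.8.3) p. 218 L5–L7, p. 219 L3] -/
def S10MemG (𝔥 : S10HDatum L μ v νHv νQv mHv mQv πSt) (𝔳 : S10Frozen L μ v νHv νQv mHv mQv πSt 𝔥)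
    (μG : Measure (G3 L).automorphicQuotient) [(G3 L).IsAutomorphicMeasure μG]
    (c : DiscreteClass (G3 L) μG) (πc : ∀ w : Pl L, IrrClass (Gqs L w)) : Prop :=
  IsLinked L 3 (qsForm L) μG c πc ∧
    ∀ w : {w : Pl L // w ≠ v}, LiesOver L μ w.1 (𝔳.K w.1) (𝔥.KH w.1) (𝔳.νQ w) (𝔳.νHw w) (𝔳.mH w) (𝔳.mQ w) (πc w.1) (𝔥.ρ w.1)

/-- **THE CORE OF THE `G`-SIDE CUT OF (13.8.3)** given `𝔥`, `𝔳` (J-A∕HC-1 (a): everything but the two finiteness clauses): the `U(Φ₃)`-datum (`μG`, `νG`), a COUNTABLE injective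
family of primitive occurrence witnesses `P i` ((β): print needs only countably many `π_w` with `a(π_w) ∈ ℤ`, p. 219 L5–L7, L. 12.7.2 p. 191; `hcount` is paid from ★
`OccursCountable` + `hinj`), their finite components with local constituents EXACTLY `[ρc i w]` (the (B·) restricted-tensor data :86–:93 VERBATIM, `loc` DEFINED), `0 < mult < ⊤`,
signs `ε_i = ±1` EQUAL to the Flath scalars `a_i` ((B2) `hsign` = the trace-based archimedean membership clause, S10#E E-F3), (B1) at `trG := classTraceAt νG 𝔳.ΦG (fun i => [P i])`
SPELLED OUT, and THE FIBRE: `hfib` (members lie over `ρ` off `v`) + `hexh` (EVERY class satisfying `S10MemG` that contributes for SOME matched pair is a member; `φ`-UNIFORM, N2).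
[cite: Rogawski1990, §13.8 (13.8.3) p. 218 L5–L7, p. 219 L1–L7; §13.6 p. 208] [cite: FlathCorvallis1979, Thm. 3] -/
structure S10GCutCore (𝔥 : S10HDatum L μ v νHv νQv mHv mQv πSt) (𝔳 : S10Frozen L μ v νHv νQv mHv mQv πSt 𝔥) : Type 1 where
  -- ═════════════ the `G = U(Φ₃)`-datum [§13.6 (13.6.1) p. 208] ═════════════
  /-- the automorphic measure on `U(Φ₃)(L⁺)\U(Φ₃)(𝔸_{L⁺})` (★ `Pinned1383Letter` :115). -/
  μG : Measure (G3 L).automorphicQuotient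
  /-- `μG` is an automorphic measure (★ `Pinned1383Letter` :116). -/
  [hμG : (G3 L).IsAutomorphicMeasure μG]
  /-- the Haar measure on `U(Φ₃)(𝔸_{L⁺})` computing `Tr π(f)` (★ `DiscreteClass.classTrace`). -/
  νG : Measure (G3 L).Adelic
  /-- `νG` is a Haar measure. -/
  [hνG : νG.IsHaarMeasure]
  -- ═════════════ the members: ONE primitive witness each ((B-d)), countable ((β)), injective (R2) ═════════════
  /-- the index of the fibre family. -/
  ι : Type
  /-- (β) the family is COUNTABLE (payer: ★ `OccursCountable` + `hinj`). -/
  hcount : Countable ι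
  /-- THE primitive occurrence witnesses `P i` of the members. -/
  P : ι → DiscreteAutomorphicRep (G3 L) μG
  /-- no class is counted twice (R2: load-bearing for `hfibre`). -/
  hinj : Function.Injective fun i => DiscreteClass.mk (P i)
  /-- finite multiplicities `m(π_i) < ⊤` (E1 row 12 BY NAME when constructed). -/
  hfin : ∀ i, (DiscreteClass.mk (P i)).mult < ⊤
  /-- positive multiplicities `0 < m(π_i)` (★ `Pinned1383Letter` :118). -/
  hpos : ∀ i, 0 < (DiscreteClass.mk (P i)).mult
  /-- the signs `ε_i` [p. 219 L1–L3 «ε_π = ±1»]. -/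
  ε : ι → ℤ
  /-- `ε_i = ±1` (★ `Pinned1383Letter` :118). -/
  hε : ∀ i, ε i = 1 ∨ ε i = -1
  -- ═════════════ (B1)–(B3): the restricted-tensor data of ★ `flath_conjuncts_of_inputs_of_locSmooth` :86–:93 VERBATIM, `loc i w := [ρc i w]` ═════════════
  /-- the archimedean × unit scalars `a_i` of the split. -/
  a : ι → ℂ
  /-- the local spaces of the restricted tensor factorisation of member `i`. -/
  Vc : ι → Pl L → Type
  /-- their additive structure. -/
  [acVc : ∀ i w, AddCommGroup (Vc i w)]
  /-- their `ℂ`-module structure. -/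
  [mdVc : ∀ i w, Module ℂ (Vc i w)]
  /-- the local factors `π_{i,w}` as representations. -/
  ρc : ∀ i w, Representation ℂ (Gqs L w) (Vc i w)
  /-- they are irreducible … -/
  hirrc : ∀ i w, (ρc i w).IsIrreducible
  /-- … and smooth (so that `loc i w := IrrClass.mk ⟨ρc i w⟩` is a class). -/
  hsmc : ∀ i w, (ρc i w).IsSmooth
  /-- the distinguished (spherical) vectors. -/
  x₀c : ∀ i w, Vc i w
  /-- the finite-adelic spaces (Flath model on `Πʳ_w U(Φ₃)(L⁺_w)`). -/
  Wc : ι → Type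
  /-- their additive structure. -/
  [acWc : ∀ i, AddCommGroup (Wc i)]
  /-- their `ℂ`-module structure. -/
  [mdWc : ∀ i, Module ℂ (Wc i)]
  /-- the finite parts `π_i^∞` as representations of `Πʳ_w U(Φ₃)(L⁺_w)`. -/
  σ : ∀ i, Representation ℂ (Πʳ w : Pl L, [Gqs L w, 𝔳.K w]) (Wc i)
  /-- the distinguished vectors are `K_w`-fixed for almost all `w`. -/
  hx₀c : ∀ i, ∀ᶠ w in cofinite, x₀c i w ∈ (ρc i w).fixedPoints (𝔳.K w)
  /-- the factorisation maps. -/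
  jc : ∀ i, RestrictedFamily (Vc i) (x₀c i) → Wc i
  /-- the exceptional sets of the factorisations. -/
  S₀c : ι → Finset (Pl L)
  /-- `π_i^∞ ≅ ⊗'_w π_{i,w}` (★ `IsRestrictedTensorProductRep`). [cite: FlathCorvallis1979, Thm. 3] -/
  hσ : ∀ i, IsRestrictedTensorProductRep (ρc i) (σ i) (hx₀c i) (jc i) (S₀c i)
  /-- the exceptional sets are inside `{v}` (all members unramified off `v`, p. 219 L3). -/
  hS₀c : ∀ i, S₀c i ⊆ {v}
  /-- off `v` the `K_w`-fixed space of `π_{i,w}` is the LINE through the distinguished vector. -/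
  hlinec : ∀ i w, w ≠ v → (ρc i w).fixedPoints (𝔳.K w) = ℂ ∙ x₀c i w
  /-- the local factors are admissible. -/
  hadmc : ∀ i w, (ρc i w).IsAdmissible
  -- ═════════════ the finite components in the `U(Φ₃)(𝔸_f)`-model of ★ `HasFinComponent`, linked to `[ρc i w]` ═════════════
  /-- the finite-adelic spaces of `π_i^∞` (★ `finAdelic` model). -/
  Wf : ι → Type
  /-- their additive structure. -/
  [acWf : ∀ i, AddCommGroup (Wf i)]
  /-- their `ℂ`-module structure. -/
  [mdWf : ∀ i, Module ℂ (Wf i)]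
  /-- `π_i^∞` as representations of `U(Φ₃)(𝔸_f)`. -/
  σf : ∀ i, Representation ℂ (finAdelic (↥(maximalRealSubfield L)) L (IsCMField.complexConj L) 3 (qsForm L)) (Wf i)
  /-- `π_i^∞` IS the finite component of `P i`. -/
  hPσf : ∀ i, (P i).HasFinComponent (σf i)
  /-- … irreducible, smooth, admissible, with local constituents EXACTLY `[ρc i w]` (so `[P i]` and its local factors cannot drift apart, F1 (iv)). -/
  hσf : ∀ i, HasLocalClasses L 3 (qsForm L) (σf i) fun w => IrrClass.mk { V := Vc i w, instAddCommGroup := acVc i w, instModule := mdVc i w, ρ := ρc i w, isIrreducible := hirrc i w, isSmooth := hsmc i w }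
  -- ═════════════ (B1)–(B2) at `trG i φ := Tr [P i](ΦG φ)` (= Lines B's `trGPinned`, C's `classTraceAt νG 𝔳.ΦG cl`) [p. 219 L1–L3] ═════════════
  /-- (B1) the ARCH–FIN SPLIT on `G` (★ :80–:82 verbatim): `Tr π_i(f_∞ ⊗ φ ⊗ 𝟙_{K^v}) = a_i · Tr π_i^∞(φ ⊗ 𝟙_{K^v})` (FED-BY ★ `stub_trace_pureTensor_of_archFinTraceSplit`'s shape). -/
  hsplit : ∀ i fH φ, MatchE1 L μ v mHv mQv fH φ →
    (DiscreteClass.mk (P i)).classTrace νG (𝔳.ΦG φ) =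
      a i * (haveI := 𝔳.hKo; @Representation.smoothTrace _ _ _ _ 𝔳.msF _ (acWc i) (mdWc i) (σ i) 𝔳.νf (fun g : Πʳ w : Pl L, [Gqs L w, 𝔳.K w] => φ (g v) *
        Set.indicator {g : Πʳ w : Pl L, [Gqs L w, 𝔳.K w] | ∀ w, w ≠ v → g w ∈ 𝔳.K w} (fun _ => (1 : ℂ)) g))
  /-- (B2) the archimedean × unit scalar IS the sign: `a_i = ε_i` [p. 218 L22–L28, p. 219 L1] — the TRACE-BASED archimedean membership clause (S10#E E-F3: `a_i = Tr π_{i,∞}(f_∞) ·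
  Π_{w ≠ v} vol(K_w) = ±1`; E2-E: DERIVED from FILE E's `isArchSignTest_frozenG` + Flath in A's payer). -/
  hsign : ∀ i, a i = ε i
  -- ═════════════ THE FIBRE [p. 219 L3; (13.8.3) p. 218 L7] ═════════════
  /-- THE FIBRE, members: every member lies over `ρ_w` at every finite `w ≠ v` [p. 219 L3 «π_v = ξ_H(ρ_v) for all v ≠ w and all π occurring in the sum»]. -/
  hfib : ∀ i (w : {w : Pl L // w ≠ v}), LiesOver L μ w.1 (𝔳.K w.1) (𝔥.KH w.1) (𝔳.νQ w) (𝔳.νHw w) (𝔳.mH w) (𝔳.mQ w)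
      (IrrClass.mk { V := Vc i w.1, instAddCommGroup := acVc i w.1, instModule := mdVc i w.1, ρ := ρc i w.1, isIrreducible := hirrc i w.1, isSmooth := hsmc i w.1 }) (𝔥.ρ w.1)
  /-- THE FIBRE, exhaustiveness (`φ`-UNIFORM, N2; R1): every discrete class of `U(Φ₃)` satisfying `S10MemG` that CONTRIBUTES for some matched pair is a member
  [(13.8.3) p. 218 L7: the sum is over ALL such `π`] — members = contributing classes; zero-trace classes over `ρ` are deliberately outside `ι` (so `hsign`'s `a_i = ±1` is consistent
  with print's `Θ_ϖ(f_∞) ∈ {0, ±1}`, AUDIT S10#5 N7). -/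
  hexh : ∀ (c : DiscreteClass (G3 L) μG) (πc : ∀ w : Pl L, IrrClass (Gqs L w)), S10MemG L μ v νHv νQv mHv mQv πSt 𝔥 𝔳 μG c πc →
    (∃ fH φ, MatchE1 L μ v mHv mQv fH φ ∧ c.classTrace νG (𝔳.ΦG φ) ≠ 0) → c ∈ Set.range fun i => DiscreteClass.mk (P i)

/-- **THE `G`-SIDE CUT = CORE + THE TWO HONEST FINITENESS CLAUSES** (J-A∕HC-1 (a); (β-1)(β-2)): `hsuppG` — for every matched pair the weighted trace vector
`i ↦ m(π_i) · Tr π_i(f_∞ ⊗ φ ⊗ 𝟙_{K^v})` has FINITE SUPPORT (so ★ `PinnedEq1383Hyp`'s `∑ᶠ` is an honest finite sum); `hfibre` — over each class `π_v` only FINITELY many members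
(= ★ `LawFibreFinite v` token shape).  Both TRUE for every core (J-A∕HC-2): members are `K^v`-spherical (`LiesOver`) with archimedean trace `a_i = ±1` against `f_∞`, so for a fixed
level at `v` (resp. a fixed `π_v`) Harish-Chandra's finiteness applies [HarishChandra1968, Thm. 1; BorelJacquet1979, §4.3]; stated over CORE tokens so that `trGPinned` unfolds by `rfl`
(FILE A's A2e `sock_S10_hcFiniteLevel` quantifies over cores). [cite: Rogawski1990, §13.8 p. 219 L5–L7; L. 12.7.2 p. 191] [cite: BorelJacquet1979, §4.3] -/
structure S10GCut (𝔥 : S10HDatum L μ v νHv νQv mHv mQv πSt) (𝔳 : S10Frozen L μ v νHv νQv mHv mQv πSt 𝔥)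
    extends S10GCutCore L μ v νHv νQv mHv mQv πSt 𝔥 𝔳 where
  /-- FINITE SUPPORT of the weighted trace vector for every matched pair (J-A∕HC-2; payer A2e). -/
  hsuppG : ∀ fH φ, MatchE1 L μ v mHv mQv fH φ →
    (Function.support fun i : ι => (((DiscreteClass.mk (P i)).mult).toNat : ℂ) * (DiscreteClass.mk (P i)).classTrace νG (𝔳.ΦG φ)).Finite
  /-- FINITE FIBRES over each class at `v` (★ `LawFibreFinite v` shape; J-A∕HC-2; payer A2e). -/
  hfibre : ∀ π : IrrClass (Gqs L v), {i : ι | IrrClass.mk { V := Vc i v, instAddCommGroup := acVc i v, instModule := mdVc i v, ρ := ρc i v, isIrreducible := hirrc i v, isSmooth := hsmc i v } = π}.Finite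

/-! ## §5 The frozen datum and its pinned functionals -/

/-- **THE FROZEN DATUM OF (13.8.3) AT `v`** `= ⟨𝔥, 𝔳, 𝔤⟩` (J-A∕C2-1; the `H`-side cut lives in `𝔥` since AUDIT S10#5 F6): FILE A's `frozenDatum_of_sockets` is literally the anonymous constructor on its `Nonempty` sockets.
[cite: Rogawski1990, §13.8 Prop. 13.8.3 (proof) pp. 218–219] -/
structure S10FrozenDatum : Type 1 where
  /-- the global `H`-datum `ρ = ρ₂ ⊠ θ`. -/
  𝔥 : S10HDatum L μ v νHv νQv mHv mQv πSt
  /-- the frozen vectors. -/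
  𝔳 : S10Frozen L μ v νHv νQv mHv mQv πSt 𝔥
  /-- the `G`-side cut (the `H`-side cut is `𝔥.dρ`, AUDIT S10#5 F6). -/
  𝔤 : S10GCut L μ v νHv νQv mHv mQv πSt 𝔥 𝔳

end Structures

end Summit.HodgeConjecture.HodgeConjecture.R90.S10

end
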